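import Summits.AtomisticToContinuum.Crystallization.Theorems.VdwKissingSutherlandSutherlandBoundHcpSum
import Literature.MathematicalPhysics.StatisticalMechanics.HcpHomogeneous
import Literature.MathematicalPhysics.StatisticalMechanics.LennardJonesClusters

/-!
# `SutherlandBound` (stmt-AtomisticToContinuum-3268): the constant `L₆(hcp)` is sharp

The item `SutherlandBound` of route `VdwKissingSutherland` (shared with `HcpThetaUniversality`)
asserts `Σ_i Σ_j |x_i − x_j|⁻⁶ ≤ N · L₆(hcp)` for every `N`-point unit packing `x` of `ℝ³`, with
`L₆(hcp) = ∑' y ∈ hcpStacking 1 √(2/3), ‖y‖⁻⁶ = 14.45489…`.  This file proves the converse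
direction of the conjectured identity `sup_N sup_x (1/N) Σ_i Σ_j |x_i − x_j|⁻⁶ = L₆(hcp)`:
the constant cannot be lowered.

* `one_le_dist_of_mem_hcpStacking` — the hcp stacking at nearest-neighbour distance `1` is a unit
  packing (from the vendored shell list `ConwaySloane1999_hcpShells_holds`);
* `hcpBall R` (local notation) — the finite unit packing `hcp ∩ B̄(0, R)`, with
  `card ≤ (2R + 1)³` (`card_hcpBall_le`);
* `sum_le_hcp_site_sum` — by homogeneity of hcp (`hcpStacking_homogeneous`: every site is the
  image of `0` under an isometry of the stacking) every site `y` with `‖y‖ + ρ ≤ R` collects, inside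
  `hcpBall R`, at least any prescribed partial sum of `L₆(hcp)` supported in `B̄(0, ρ)`;
* `exists_hcpBall_card_le_mul` — polynomial growth gives radii `R` with
  `#hcpBall (R + ρ) ≤ (1 + c) · #hcpBall R` (few boundary sites);
* `sutherlandBound_sharp` — for every `ε > 0` some finite unit packing (a ball of hcp) has
  `Σ_i Σ_j |x_i − x_j|⁻⁶ ≥ N · (L₆(hcp) − ε)`;
* `hcp_tsum_le_of_packing_bound` — hence any constant `C` with `Σ_i Σ_j |x_i − x_j|⁻⁶ ≤ N · C`
  for all finite unit packings satisfies `L₆(hcp) ≤ C`: if `SutherlandBound` holds it is optimal,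
  and a refutation must exhibit a packing beating `L₆(hcp)` itself;
* `sutherlandBound_iff_isLeast` — `SutherlandBound` ↔ `L₆(hcp)` is the least packing constant;
* `hcp_site_tsum_eq` — every site of hcp has site sum exactly `L₆(hcp)` (vertex-transitivity).

[folklore]
-/

noncomputable section

namespace Summit.AtomisticToContinuum.Crystallization.Theorems

open Literature.MathematicalPhysics.StatisticalMechanics Literature.Barriers.AtomisticToContinuum

/-- **hcp at nearest-neighbour distance `1` is a unit packing**: distinct sites are at distance
`≥ 1` (the distances `≤ 2` between sites are `0, 1, √2, √(8/3), √3, √(11/3), 2`,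
`ConwaySloane1999_hcpShells_holds`). [folklore] -/
theorem one_le_dist_of_mem_hcpStacking {x y : EuclideanSpace ℝ (Fin 3)}
    (hx : x ∈ hcpStacking 1 (Real.sqrt (2 / 3))) (hy : y ∈ hcpStacking 1 (Real.sqrt (2 / 3)))
    (hxy : x ≠ y) : 1 ≤ dist x y := by
  by_cases h2 : dist x y ≤ 2
  · obtain ⟨-, -, -, -, -, -, hd⟩ := ConwaySloane1999_hcpShells_holds x hx
    have hmem := hd y hy h2
    have hne : dist x y ≠ 0 := dist_ne_zero.2 hxy
    have hs : ∀ t : ℝ, 1 ≤ t → (1 : ℝ) ≤ Real.sqrt t := fun t ht => by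
      rw [show (1 : ℝ) = Real.sqrt 1 from Real.sqrt_one.symm]
      exact Real.sqrt_le_sqrt ht
    simp only [Set.mem_insert_iff, Set.mem_singleton_iff] at hmem
    rcases hmem with h | h | h | h | h | h | h
    · exact absurd h hne
    · rw [h]
    · rw [h]; exact hs _ (by norm_num)
    · rw [h]; exact hs _ (by norm_num)
    · rw [h]; exact hs _ (by norm_num)
    · rw [h]; exact hs _ (by norm_num)
    · rw [h]; norm_num
  · push Not at h2
    linarith

/-- The hcp sites of norm `≤ R` form a finite set (uniform discreteness). [folklore] -/
theorem finite_hcpStacking_inter_closedBall (R : ℝ) :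
    (hcpStacking 1 (Real.sqrt (2 / 3)) ∩
      Metric.closedBall (0 : EuclideanSpace ℝ (Fin 3)) R).Finite :=
  uniformlyDiscrete_hcpStacking.finite_inter_closedBall 0 R

/-- **The hcp ball** `hcpBall R`: local notation for the finset of sites of
`hcpStacking 1 √(2/3)` of norm `≤ R` (the `toFinset` of `finite_hcpStacking_inter_closedBall R`;
a notation, not a definition). -/
local notation3 "hcpBall " R:max => Set.Finite.toFinset (finite_hcpStacking_inter_closedBall R)

/-- Membership in the hcp ball. [folklore] -/
theorem mem_hcpBall {R : ℝ} {z : EuclideanSpace ℝ (Fin 3)} :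
    z ∈ hcpBall R ↔ z ∈ hcpStacking 1 (Real.sqrt (2 / 3)) ∧ ‖z‖ ≤ R := by
  rw [Set.Finite.mem_toFinset, Set.mem_inter_iff, mem_closedBall_zero_iff]

/-- The origin is a site of every hcp ball of non-negative radius. [folklore] -/
theorem zero_mem_hcpBall {R : ℝ} (hR : 0 ≤ R) : (0 : EuclideanSpace ℝ (Fin 3)) ∈ hcpBall R :=
  mem_hcpBall.2 ⟨⟨0, 0, 0, by simp [barlowPos]⟩, by rwa [norm_zero]⟩

/-- hcp balls increase with the radius. [folklore] -/
theorem hcpBall_mono {R R' : ℝ} (h : R ≤ R') : hcpBall R ⊆ hcpBall R' := fun z hz => by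
  rw [mem_hcpBall] at hz ⊢
  exact ⟨hz.1, hz.2.trans h⟩

/-- **Polynomial growth**: `#hcpBall R ≤ (2R + 1)³` (disjoint balls of radius `1/2`,
`card_le_of_separated_of_dist_le`). [folklore] -/
theorem card_hcpBall_le {R : ℝ} (hR : 0 ≤ R) : ((hcpBall R).card : ℝ) ≤ (2 * R + 1) ^ 3 := by
  have h := card_le_of_separated_of_dist_le (hcpBall R) 0 one_pos hR
    (fun c hc => by rw [dist_zero_right]; exact (mem_hcpBall.1 hc).2)
    (fun c hc d hd hcd =>
      one_le_dist_of_mem_hcpStacking (mem_hcpBall.1 hc).1 (mem_hcpBall.1 hd).1 hcd)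
  rw [finrank_euclideanSpace_fin, div_one] at h
  exact h

/-- **Partial sums of `L₆(hcp)`**: for every `ε > 0` a finite set of sites already carries more
than `L₆(hcp) − ε` (summability, `summable_hcp_inv_norm_pow_six`). [folklore] -/
theorem exists_finset_hcp_sum_gt {ε : ℝ} (hε : 0 < ε) :
    ∃ T : Finset (EuclideanSpace ℝ (Fin 3)), (∀ q ∈ T, q ∈ hcpStacking 1 (Real.sqrt (2 / 3))) ∧
      (∑' y : ↥(hcpStacking 1 (Real.sqrt (2 / 3))), ‖(y : EuclideanSpace ℝ (Fin 3))‖⁻¹ ^ 6) - ε <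
        ∑ q ∈ T, ‖q‖⁻¹ ^ 6 := by
  classical
  have hs := summable_hcp_inv_norm_pow_six.hasSum
  have ht : Filter.Tendsto
      (fun s : Finset ↥(hcpStacking 1 (Real.sqrt (2 / 3))) =>
        ∑ b ∈ s, ‖(b : EuclideanSpace ℝ (Fin 3))‖⁻¹ ^ 6)
      Filter.atTop
      (nhds (∑' y : ↥(hcpStacking 1 (Real.sqrt (2 / 3))), ‖(y : EuclideanSpace ℝ (Fin 3))‖⁻¹ ^ 6)) := by
    have h' := hs
    unfold HasSum at h'
    simpa only [SummationFilter.unconditional_filter] using h'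
  have hlt : (∑' y : ↥(hcpStacking 1 (Real.sqrt (2 / 3))), ‖(y : EuclideanSpace ℝ (Fin 3))‖⁻¹ ^ 6) - ε <
      ∑' y : ↥(hcpStacking 1 (Real.sqrt (2 / 3))), ‖(y : EuclideanSpace ℝ (Fin 3))‖⁻¹ ^ 6 := by
    linarith
  obtain ⟨s, hs'⟩ := (ht.eventually_const_lt hlt).exists
  refine ⟨s.image Subtype.val, fun q hq => ?_, ?_⟩
  · obtain ⟨b, -, rfl⟩ := Finset.mem_image.1 hq
    exact b.2
  · rw [Finset.sum_image fun a _ b _ h => Subtype.val_injective h]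
    exact hs'

/-- **Homogeneity transports partial sums to every site.** If `T` is a finite set of hcp sites of
norm `≤ ρ` and `y` is a site with `‖y‖ + ρ ≤ R`, then the site sum of `y` inside `hcpBall R`
dominates `∑_{q ∈ T} ‖q‖⁻⁶`: the isometry `B` of `hcpStacking_homogeneous` maps `T` onto sites
`y + B q ∈ hcpBall R` at the same distances from `y`. [folklore] -/
theorem sum_le_hcp_site_sum {T : Finset (EuclideanSpace ℝ (Fin 3))}
    (hT : ∀ q ∈ T, q ∈ hcpStacking 1 (Real.sqrt (2 / 3))) {ρ : ℝ} (hρ : ∀ q ∈ T, ‖q‖ ≤ ρ)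
    {y : EuclideanSpace ℝ (Fin 3)} (hy : y ∈ hcpStacking 1 (Real.sqrt (2 / 3))) {R : ℝ}
    (hyR : ‖y‖ + ρ ≤ R) :
    ∑ q ∈ T, ‖q‖⁻¹ ^ 6 ≤ ∑ z ∈ hcpBall R, ‖z - y‖⁻¹ ^ 6 := by
  classical
  obtain ⟨B, hB⟩ := hcpStacking_homogeneous 1 (Real.sqrt (2 / 3)) hy
  have hinj : Set.InjOn (fun q => y + B q) ↑T := fun q _ q' _ h =>
    B.injective (add_left_cancel h)
  calc ∑ q ∈ T, ‖q‖⁻¹ ^ 6 = ∑ q ∈ T, ‖(y + B q) - y‖⁻¹ ^ 6 := by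
        refine Finset.sum_congr rfl fun q _ => ?_
        rw [add_sub_cancel_left, LinearIsometryEquiv.norm_map]
    _ = ∑ z ∈ T.image (fun q => y + B q), ‖z - y‖⁻¹ ^ 6 :=
        (Finset.sum_image (f := fun z => ‖z - y‖⁻¹ ^ 6) hinj).symm
    _ ≤ ∑ z ∈ hcpBall R, ‖z - y‖⁻¹ ^ 6 := by
        refine Finset.sum_le_sum_of_subset_of_nonneg (fun z hz => ?_) fun _ _ _ => by positivity
        obtain ⟨q, hq, rfl⟩ := Finset.mem_image.1 hz
        rw [mem_hcpBall]
        refine ⟨(hB q).1 (hT q hq), ?_⟩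
        calc ‖y + B q‖ ≤ ‖y‖ + ‖B q‖ := norm_add_le _ _
          _ = ‖y‖ + ‖q‖ := by rw [LinearIsometryEquiv.norm_map]
          _ ≤ R := by linarith [hρ q hq]

/-- **Few boundary sites at some radius.** For `c > 0` and `ρ > 0` there is a radius `R ≥ 0` with
`#hcpBall (R + ρ) ≤ (1 + c) · #hcpBall R`: otherwise `#hcpBall (m ρ) ≥ (1 + c)^m`, against the
cubic bound `card_hcpBall_le`. [folklore] -/
theorem exists_hcpBall_card_le_mul {c ρ : ℝ} (hc : 0 < c) (hρ : 0 < ρ) :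
    ∃ R : ℝ, 0 ≤ R ∧ ((hcpBall (R + ρ)).card : ℝ) ≤ (1 + c) * (hcpBall R).card := by
  by_contra hcon
  push Not at hcon
  -- exponential growth along the radii `m ρ`
  have hgrow : ∀ m : ℕ, (1 + c) ^ m ≤ ((hcpBall (m * ρ)).card : ℝ) := by
    intro m
    induction m with
    | zero =>
      have h0 : (0 : EuclideanSpace ℝ (Fin 3)) ∈ hcpBall ((0 : ℕ) * ρ) :=
        zero_mem_hcpBall (by simp)
      have h1 : 1 ≤ (hcpBall ((0 : ℕ) * ρ)).card := Finset.card_pos.2 ⟨0, h0⟩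
      rw [pow_zero]
      exact_mod_cast h1
    | succ m ih =>
      have hR : (0 : ℝ) ≤ m * ρ := by positivity
      have h1 := hcon (m * ρ) hR
      have hc1 : (0 : ℝ) ≤ 1 + c := by linarith
      calc (1 + c) ^ (m + 1) = (1 + c) * (1 + c) ^ m := by ring
        _ ≤ (1 + c) * (hcpBall (m * ρ)).card := mul_le_mul_of_nonneg_left ih hc1
        _ ≤ (hcpBall (m * ρ + ρ)).card := h1.le
        _ = (hcpBall (((m + 1 : ℕ) : ℝ) * ρ)).card := by push_cast; ring_nf
  -- cubic upper bound along the same radii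
  have hub : ∀ m : ℕ, ((hcpBall (m * ρ)).card : ℝ) ≤ (2 * ρ + 1) ^ 3 * ((m : ℝ) + 1) ^ 3 := by
    intro m
    have hm : (0 : ℝ) ≤ m := Nat.cast_nonneg m
    have hR : (0 : ℝ) ≤ m * ρ := by positivity
    have hle : 2 * ((m : ℝ) * ρ) + 1 ≤ (2 * ρ + 1) * ((m : ℝ) + 1) := by nlinarith
    calc ((hcpBall (m * ρ)).card : ℝ) ≤ (2 * (m * ρ) + 1) ^ 3 := card_hcpBall_le hR
      _ ≤ ((2 * ρ + 1) * ((m : ℝ) + 1)) ^ 3 := by gcongr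
      _ = (2 * ρ + 1) ^ 3 * ((m : ℝ) + 1) ^ 3 := by ring
  -- but `(m+1)³ / (1+c)^(m+1) → 0`
  have hlim := tendsto_pow_const_div_const_pow_of_one_lt 3 (show (1 : ℝ) < 1 + c by linarith)
  have hA : (0 : ℝ) < (2 * ρ + 1) ^ 3 * (1 + c) := by positivity
  have hev := (Filter.tendsto_add_atTop_nat 1).eventually (hlim.eventually (gt_mem_nhds (inv_pos.2 hA)))
  obtain ⟨m, hm⟩ := hev.exists
  have hm' : (((m + 1 : ℕ) : ℝ)) ^ 3 / (1 + c) ^ (m + 1) < ((2 * ρ + 1) ^ 3 * (1 + c))⁻¹ := hm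
  rw [div_lt_iff₀ (by positivity)] at hm'
  have key : (2 * ρ + 1) ^ 3 * ((m : ℝ) + 1) ^ 3 < (1 + c) ^ m := by
    have h1 : ((2 * ρ + 1) ^ 3 * (1 + c))⁻¹ * (1 + c) ^ (m + 1) =
        (1 + c) ^ m / (2 * ρ + 1) ^ 3 := by
      have hc0 : (1 + c) ≠ 0 := by positivity
      have hρ0 : (2 * ρ + 1) ^ 3 ≠ 0 := by positivity
      field_simp
      ring
    rw [h1, lt_div_iff₀ (by positivity)] at hm'
    push_cast at hm'
    linarith [hm']
  linarith [hgrow m, hub m, key]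

/-- **The constant of `SutherlandBound` is attained asymptotically by balls of hcp**: for every
`ε > 0` there is a finite unit packing `x` of `ℝ³` (`N ≥ 1` points of `hcpStacking 1 √(2/3)`)
with `Σ_i Σ_j |x_i − x_j|⁻⁶ ≥ N · (L₆(hcp) − ε)`.  (Interior sites of a large hcp ball see a
prescribed partial sum of `L₆(hcp)` by homogeneity; the boundary layer is negligible at the radii
of `exists_hcpBall_card_le_mul`.) [folklore] -/
theorem sutherlandBound_sharp {ε : ℝ} (hε : 0 < ε) :
    ∃ N : ℕ, 0 < N ∧ ∃ x : Fin N → EuclideanSpace ℝ (Fin 3),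
      (∀ i j, i ≠ j → 1 ≤ dist (x i) (x j)) ∧
      (N : ℝ) * ((∑' y : ↥(hcpStacking 1 (Real.sqrt (2 / 3))),
          ‖(y : EuclideanSpace ℝ (Fin 3))‖⁻¹ ^ 6) - ε) ≤ ∑ i, ∑ j, (dist (x i) (x j))⁻¹ ^ 6 := by
  classical
  set L := ∑' y : ↥(hcpStacking 1 (Real.sqrt (2 / 3))), ‖(y : EuclideanSpace ℝ (Fin 3))‖⁻¹ ^ 6
    with hL
  by_cases hεL : L ≤ ε
  · refine ⟨1, one_pos, fun _ => 0, fun i j hij => absurd (Subsingleton.elim i j) hij, ?_⟩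
    have h0 : (0 : ℝ) ≤ ∑ i : Fin 1, ∑ j : Fin 1,
        (dist ((fun _ : Fin 1 => (0 : EuclideanSpace ℝ (Fin 3))) i)
          ((fun _ : Fin 1 => (0 : EuclideanSpace ℝ (Fin 3))) j))⁻¹ ^ 6 :=
      Finset.sum_nonneg fun _ _ => Finset.sum_nonneg fun _ _ => by positivity
    have h1 : ((1 : ℕ) : ℝ) * (L - ε) ≤ 0 := by push_cast; linarith
    exact h1.trans h0
  push Not at hεL
  -- a partial sum of `L` above `L - ε/2`, supported in the ball of radius `ρ ≥ 1`
  obtain ⟨T, hTH, hTsum⟩ := exists_finset_hcp_sum_gt (half_pos hε)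
  obtain ⟨ρ, hρ1, hρT⟩ : ∃ ρ : ℝ, 1 ≤ ρ ∧ ∀ q ∈ T, ‖q‖ ≤ ρ := by
    refine ⟨max 1 (∑ q ∈ T, ‖q‖), le_max_left _ _, fun q hq => ?_⟩
    exact (Finset.single_le_sum (fun q _ => norm_nonneg q) hq).trans (le_max_right _ _)
  have hρ : 0 < ρ := by linarith
  -- a radius with few boundary sites
  have hLpos : 0 < L := by linarith
  set c := ε / (2 * L) with hc
  have hcpos : 0 < c := by positivity
  obtain ⟨R, hR0, hcard⟩ := exists_hcpBall_card_le_mul hcpos hρ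
  -- the packing: the hcp ball of radius `R + ρ`
  set X := hcpBall (R + ρ) with hX
  have hXpos : 0 < X.card := Finset.card_pos.2 ⟨0, zero_mem_hcpBall (by linarith)⟩
  refine ⟨X.card, hXpos, fun i => (X.equivFin.symm i : EuclideanSpace ℝ (Fin 3)), ?_, ?_⟩
  · intro i j hij
    refine one_le_dist_of_mem_hcpStacking (mem_hcpBall.1 (X.equivFin.symm i).2).1
      (mem_hcpBall.1 (X.equivFin.symm j).2).1 fun h => hij ?_
    exact X.equivFin.symm.injective (Subtype.val_injective h)
  · -- rewrite the double sum over `Fin N` as a double sum over the finset `X`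
    have hre : ∑ i, ∑ j, (dist (X.equivFin.symm i : EuclideanSpace ℝ (Fin 3))
        (X.equivFin.symm j : EuclideanSpace ℝ (Fin 3)))⁻¹ ^ 6 =
        ∑ z ∈ X, ∑ w ∈ X, (dist z w)⁻¹ ^ 6 := by
      have inner : ∀ z : EuclideanSpace ℝ (Fin 3),
          ∑ j, (dist z (X.equivFin.symm j : EuclideanSpace ℝ (Fin 3)))⁻¹ ^ 6 =
            ∑ w ∈ X, (dist z w)⁻¹ ^ 6 := fun z => by
        rw [Fintype.sum_equiv X.equivFin.symm _
          (fun w : X => (dist z (w : EuclideanSpace ℝ (Fin 3)))⁻¹ ^ 6) (fun _ => rfl)]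
        exact Finset.sum_coe_sort X (fun w => (dist z w)⁻¹ ^ 6)
      simp_rw [inner]
      rw [Fintype.sum_equiv X.equivFin.symm _
        (fun z : X => ∑ w ∈ X, (dist (z : EuclideanSpace ℝ (Fin 3)) w)⁻¹ ^ 6) (fun _ => rfl)]
      exact Finset.sum_coe_sort X (fun z => ∑ w ∈ X, (dist z w)⁻¹ ^ 6)
    rw [hre]
    -- every inner site collects at least `L - ε/2`
    have hinner : ∀ z ∈ hcpBall R, L - ε / 2 ≤ ∑ w ∈ X, (dist z w)⁻¹ ^ 6 := by
      intro z hz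
      obtain ⟨hzH, hzR⟩ := mem_hcpBall.1 hz
      have h1 := sum_le_hcp_site_sum hTH hρT hzH (show ‖z‖ + ρ ≤ R + ρ by linarith)
      have h2 : ∑ w ∈ X, ‖w - z‖⁻¹ ^ 6 = ∑ w ∈ X, (dist z w)⁻¹ ^ 6 :=
        Finset.sum_congr rfl fun w _ => by rw [dist_eq_norm, norm_sub_rev]
      linarith [h1, h2]
    -- bookkeeping: `(1 + c)(L - ε) ≤ L - ε/2` for `c = ε/(2L)`
    have hcL : c * L = ε / 2 := by
      rw [hc]; field_simp
    have hkey : (1 + c) * (L - ε) ≤ L - ε / 2 := by nlinarith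
    have hn : (0 : ℝ) ≤ (hcpBall R).card := Nat.cast_nonneg _
    calc (X.card : ℝ) * (L - ε)
        ≤ (1 + c) * (hcpBall R).card * (L - ε) :=
          mul_le_mul_of_nonneg_right hcard (by linarith)
      _ = (hcpBall R).card * ((1 + c) * (L - ε)) := by ring
      _ ≤ (hcpBall R).card * (L - ε / 2) := mul_le_mul_of_nonneg_left hkey hn
      _ = ∑ _z ∈ hcpBall R, (L - ε / 2) := by rw [Finset.sum_const, nsmul_eq_mul]
      _ ≤ ∑ z ∈ hcpBall R, ∑ w ∈ X, (dist z w)⁻¹ ^ 6 := Finset.sum_le_sum hinner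
      _ ≤ ∑ z ∈ X, ∑ w ∈ X, (dist z w)⁻¹ ^ 6 :=
          Finset.sum_le_sum_of_subset_of_nonneg (hcpBall_mono (by linarith)) fun _ _ _ =>
            Finset.sum_nonneg fun _ _ => by positivity

/-- **Optimality of the hcp constant.** Any constant `C` that bounds the `r⁻⁶` double sum of
every finite unit packing of `ℝ³` by `N · C` satisfies `L₆(hcp) ≤ C`; in particular the constant
of `SutherlandBound` cannot be improved, and `SutherlandBound` is equivalent to
`sup_N sup_x (1/N) Σ_i Σ_j |x_i − x_j|⁻⁶ = L₆(hcp)`. [folklore] -/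
theorem hcp_tsum_le_of_packing_bound {C : ℝ}
    (hC : ∀ (N : ℕ) (x : Fin N → EuclideanSpace ℝ (Fin 3)),
      (∀ i j, i ≠ j → 1 ≤ dist (x i) (x j)) → ∑ i, ∑ j, (dist (x i) (x j))⁻¹ ^ 6 ≤ (N : ℝ) * C) :
    (∑' y : ↥(hcpStacking 1 (Real.sqrt (2 / 3))), ‖(y : EuclideanSpace ℝ (Fin 3))‖⁻¹ ^ 6) ≤ C := by
  by_contra h
  push Not at h
  obtain ⟨N, hN, x, hx, hsum⟩ := sutherlandBound_sharp (ε :=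
    ((∑' y : ↥(hcpStacking 1 (Real.sqrt (2 / 3))), ‖(y : EuclideanSpace ℝ (Fin 3))‖⁻¹ ^ 6) - C) / 2)
    (by linarith)
  have h2 := hC N x hx
  have hN' : (0 : ℝ) < N := by exact_mod_cast hN
  nlinarith

/-- **`SutherlandBound` says exactly that `L₆(hcp)` is the least packing constant**: the item
holds iff `L₆(hcp)` is the least `C` with `Σ_i Σ_j |x_i − x_j|⁻⁶ ≤ N · C` for every finite unit
packing `x` of `ℝ³` (the minimality half is unconditional, `hcp_tsum_le_of_packing_bound`).
[folklore] -/
theorem sutherlandBound_iff_isLeast :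
    Theses.VdwKissingSutherland.SutherlandBound ↔
      IsLeast {C : ℝ | ∀ (N : ℕ) (x : Fin N → EuclideanSpace ℝ (Fin 3)),
        (∀ i j, i ≠ j → 1 ≤ dist (x i) (x j)) →
          ∑ i, ∑ j, (dist (x i) (x j))⁻¹ ^ 6 ≤ (N : ℝ) * C}
        (∑' y : ↥(hcpStacking 1 (Real.sqrt (2 / 3))), ‖(y : EuclideanSpace ℝ (Fin 3))‖⁻¹ ^ 6) :=
  ⟨fun h => ⟨h, fun _ hC => hcp_tsum_le_of_packing_bound hC⟩, fun h => h.1⟩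

/-- **Site-independence of `L₆(hcp)`.** The `r⁻⁶` sum of the hcp stacking seen from any of its
sites equals the sum seen from the origin: `∑' z ∈ hcp, ‖z − p₀‖⁻⁶ = L₆(hcp)` for every site
`p₀` (transport along the isometry of `hcpStacking_homogeneous`; hcp is vertex-transitive although
it is not a lattice). In particular every site of the infinite hcp packing has site sum exactly
`L₆(hcp)`, the equality case of `SutherlandBound` per site. [folklore] -/
theorem hcp_site_tsum_eq {p₀ : EuclideanSpace ℝ (Fin 3)}
    (hp₀ : p₀ ∈ hcpStacking 1 (Real.sqrt (2 / 3))) :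
    ∑' z : ↥(hcpStacking 1 (Real.sqrt (2 / 3))), ‖(z : EuclideanSpace ℝ (Fin 3)) - p₀‖⁻¹ ^ 6 =
      ∑' y : ↥(hcpStacking 1 (Real.sqrt (2 / 3))), ‖(y : EuclideanSpace ℝ (Fin 3))‖⁻¹ ^ 6 := by
  obtain ⟨B, hB⟩ := hcpStacking_homogeneous 1 (Real.sqrt (2 / 3)) hp₀
  have hinv : ∀ z : EuclideanSpace ℝ (Fin 3), p₀ + B (B.symm (z - p₀)) = z := fun z => by
    rw [LinearIsometryEquiv.apply_symm_apply, add_sub_cancel]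
  let e : ↥(hcpStacking 1 (Real.sqrt (2 / 3))) ≃ ↥(hcpStacking 1 (Real.sqrt (2 / 3))) :=
    { toFun := fun q => ⟨p₀ + B q, (hB q).1 q.2⟩
      invFun := fun z => ⟨B.symm ((z : EuclideanSpace ℝ (Fin 3)) - p₀), by
        have h := (hB (B.symm ((z : EuclideanSpace ℝ (Fin 3)) - p₀))).2
        rw [hinv] at h
        exact h z.2⟩
      left_inv := fun q => by
        ext : 1
        show B.symm ((p₀ + B q) - p₀) = q
        rw [add_sub_cancel_left, LinearIsometryEquiv.symm_apply_apply]
      right_inv := fun z => by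
        ext : 1
        exact hinv z }
  calc ∑' z : ↥(hcpStacking 1 (Real.sqrt (2 / 3))), ‖(z : EuclideanSpace ℝ (Fin 3)) - p₀‖⁻¹ ^ 6
      = ∑' q : ↥(hcpStacking 1 (Real.sqrt (2 / 3))),
          ‖((e q : ↥(hcpStacking 1 (Real.sqrt (2 / 3)))) : EuclideanSpace ℝ (Fin 3)) - p₀‖⁻¹ ^ 6 :=
        (Equiv.tsum_eq e (fun z : ↥(hcpStacking 1 (Real.sqrt (2 / 3))) =>
          ‖(z : EuclideanSpace ℝ (Fin 3)) - p₀‖⁻¹ ^ 6)).symm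
    _ = ∑' q : ↥(hcpStacking 1 (Real.sqrt (2 / 3))), ‖(q : EuclideanSpace ℝ (Fin 3))‖⁻¹ ^ 6 := by
        refine tsum_congr fun q => ?_
        show ‖(p₀ + B q) - p₀‖⁻¹ ^ 6 = _
        rw [add_sub_cancel_left, LinearIsometryEquiv.norm_map]

end Summit.AtomisticToContinuum.Crystallization.Theorems
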